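import Summits.QuantumFields.BalabanUV.Beta.RootedJetReflection

/-!
# `BalabanUV.Beta.RootedJetTwist` — THE `τ₁τ₂`-TWIST LEMMA FOR THE ROOTED AVERAGED JET ON THE GENERAL-BACKGROUND CHART:
# twisting the background pair by `(1 + τ₁τ₂ ι δ, 1 − τ₁τ₂ ι δ)` shifts the jet by `τ₁τ₂ ·` (a FIRST-ORDER jet in `δ`), which is ODD in `δ`
# (β sub-cell, row D1 letter chain HR-W-LET, an1's list «NOT in AN1-28B (next)» item 2 «D-splitting»; an3 gen 33, an1 first refusal)

HONEST FRAMING (cell charter, verbatim): «discharging BetaPertH makes Bałaban's UV stability UNCONDITIONAL — a real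
constructive-QFT result; it is NOT the continuum limit and NOT the Clay problem.»  HONEST DEPENDENCY (verbatim): «continuum YM on
T⁴ ⇐ BetaPertH ∧ nine spine estimates (0/9 proved); BetaPertH ⇐ (D1) ∧ (D4) ∧ CAP+tail; G-an2-4 gates asym, D1 and NE2/3/4.»
DERIVED cell leaf: [folklore] ring algebra — node 12's naturality method (`map_PhiGAt`, `map_logT`, `map_invT`) along three
`𝕜`-algebra maps `Tau (𝔸[ε]) → Tau 𝔸` on the general-background chart `GfL`∕`GbL`∕`QjetLAt` of `RootedJetReflection`.  No statement of
Bałaban's papers is typed here, no `[cite:]` tag, no `Prop` is minted, no binder of the β-function wall (`hW`/`hR`/`D1Tel`/`D1Rep`, (D1),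
`BetaPertH`) is instantiated or discharged.  NOT summit progress.

## What this module proves

By `RootedJetReflectionExpanded.reflPair_Ebg_Ebi`∕`_Ebi_Ebg` the reflected background pair of the chart is the ordered chart of the
reflected backgrounds TWISTED on the axis: `(E·(1 + τ₁τ₂ ι δ), (1 − τ₁τ₂ ι δ)·Ē)` with `δ = dR` odd under `B ↔ B′`.  Here, for ANY
letters `ω, E, Ē ∈ Tau 𝔸` and any `δ : Form1 d 𝔸`:
* §1 three algebra maps out of `Tau (𝔸[ε])` (`𝔸[ε] = DualNumber 𝔸`): `twistHom` (`ε ↦ τ₁τ₂`), `killHom` (`ε ↦ 0`), `lineHom ∘ aug`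
  (`τ₁, τ₂ ↦ 0`, then `ε ↦ τ₁`), and the pointwise identity `twistHom q = killHom q + τ₁τ₂ · ι (c10 (lineHom (aug q)))` (`twist_decomp`);
  the `τ₁`-sign flip `flip1 : Tau 𝔸 →ₐ Tau 𝔸`.
* §2 NATURALITY of `QjetLAt` under algebra maps of the letter algebra (`map_QjetLAt`) and the images of the `ε`-LIFTED letters
  `liftF ω`, `twF E δ := Ê·ι(1 + εδ)`, `twB Ē δ := ι(1 − εδ)·Ē̂` under the three maps.
* §3 **THE TWIST LEMMA** `QjetLAt_twist`:
  `QjetLAt ρ ω (E·(1+τ₁τ₂ιδ)) ((1−τ₁τ₂ιδ)·Ē) = QjetLAt ρ ω E Ē + τ₁τ₂ · ι (c10 (QjetLAt ρ ω♭ E♭ Ē♭))` with the SCALAR SHADOWS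
  `ω♭ = ι(c00 ω)`, `E♭ = ι(c00 E)·(1 + τ₁ιδ)`, `Ē♭ = (1 − τ₁ιδ)·ι(c00 Ē)`; hence the `c00`∕`c10`∕`c01` components are UNCHANGED and
  `c11` shifts by `c10` of a first-order jet in `δ` (`c11_QjetLAt_twist`; for augmentation-one backgrounds the shift is
  `c10 (QjetAt ρ ω♭ δ 0)`, node 12b's jet, `c11_QjetLAt_twist_of_aug`).
* §4 ODDNESS: `c10 (QjetAt ρ (ι∘a) (−δ) 0) = − c10 (QjetAt ρ (ι∘a) δ 0)` (`c10_QjetAt_neg`, via `flip1`), hence **the twist CANCELS in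
  any `δ ↦ −δ` symmetrised sum of `c11`-components** (`c11_QjetLAt_twist_symm`) — the form in which it enters `T2At` under reflection.

## What is NOT here
The assembly of the reflection law of `T2At` (next module), the mixed chart, tables, packing.
-/

namespace Summit.QuantumFields.BalabanUV.Beta.RootedJetTwist

open Literature.MathematicalPhysics.QuantumFieldTheory.Balaban1983to89
open Literature.MathematicalPhysics.QuantumFieldTheory.Balaban1983to89.Beta
open AffineAveraging (Form1)
open AveragingThirdJet (Tau Rho dmk fst_dmk snd_dmk dfst_mul dsnd_mul mapDual fst_mapDual snd_mapDual scaleDual fst_scaleDual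
  snd_scaleDual Ebg Ebi logT invT map_logT map_invT)
open AveragingThirdJet.Tau (τ₁ τ₂ τ12 ι c00 c10 c01 c11 ext4 aug aug_apply)
open AveragingMixedJetTables (PhiGAt map_PhiGAt QjetAt)
open Summit.QuantumFields.BalabanUV.Beta.RootedJetReflection (GfL GbL PhiLAt QjetLAt fst_GfL snd_GfL fst_GbL snd_GbL
  QjetAt_eq_QjetLAt)

variable {𝕜 : Type*} [Field 𝕜] {d : ℕ} {𝔸 : Type*} [Ring 𝔸] [Algebra 𝕜 𝔸]

/-! ## §1 Three algebra maps `Tau (𝔸[ε]) → Tau 𝔸` and the `τ₁`-flip -/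

/-- [folklore] THE TWIST MAP `ε ↦ τ₁τ₂` (`τ₁, τ₂` fixed): `mk a b c e ↦ mk a₀ b₀ c₀ (e₀ + a₁)` — an algebra map because `τ₁τ₂` is
central of square zero and annihilated by `τ₁`, `τ₂`. -/
def twistHom : Tau (DualNumber 𝔸) →ₐ[𝕜] Tau 𝔸 where
  toFun q := Tau.mk (c00 q).fst (c10 q).fst (c01 q).fst ((c11 q).fst + (c00 q).snd)
  map_one' := ext4 (by simp) (by simp) (by simp) (by simp)
  map_mul' p q := ext4 (by simp) (by simp) (by simp)
    (by simp only [AveragingThirdJet.Tau.c11_mul, AveragingThirdJet.Tau.c00_mul, TrivSqZeroExt.fst_add, dfst_mul, dsnd_mul,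
        AveragingThirdJet.Tau.c11_mk, AveragingThirdJet.Tau.c00_mk, AveragingThirdJet.Tau.c10_mk, AveragingThirdJet.Tau.c01_mk,
        mul_add, add_mul]; abel)
  map_zero' := ext4 (by simp) (by simp) (by simp) (by simp)
  map_add' p q := ext4 (by simp) (by simp) (by simp)
    (by simp only [AveragingThirdJet.Tau.c11_add, AveragingThirdJet.Tau.c00_add, TrivSqZeroExt.fst_add, TrivSqZeroExt.snd_add,
        AveragingThirdJet.Tau.c11_mk]; abel)
  commutes' r := ext4 (by simp [Algebra.algebraMap_eq_smul_one]) (by simp [Algebra.algebraMap_eq_smul_one])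
    (by simp [Algebra.algebraMap_eq_smul_one]) (by simp [Algebra.algebraMap_eq_smul_one])

/-- [folklore] Components of the twist map. -/
@[simp] theorem c00_twistHom (q : Tau (DualNumber 𝔸)) : c00 (twistHom (𝕜 := 𝕜) q) = (c00 q).fst := rfl
/-- [folklore] -/
@[simp] theorem c10_twistHom (q : Tau (DualNumber 𝔸)) : c10 (twistHom (𝕜 := 𝕜) q) = (c10 q).fst := rfl
/-- [folklore] -/
@[simp] theorem c01_twistHom (q : Tau (DualNumber 𝔸)) : c01 (twistHom (𝕜 := 𝕜) q) = (c01 q).fst := rfl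
/-- [folklore] -/
@[simp] theorem c11_twistHom (q : Tau (DualNumber 𝔸)) : c11 (twistHom (𝕜 := 𝕜) q) = (c11 q).fst + (c00 q).snd := rfl

/-- [folklore] THE KILL MAP `ε ↦ 0`. -/
def killHom : Tau (DualNumber 𝔸) →ₐ[𝕜] Tau 𝔸 := mapDual (mapDual (TrivSqZeroExt.fstHom 𝕜 𝔸 𝔸))

/-- [folklore] Components of the kill map. -/
@[simp] theorem c00_killHom (q : Tau (DualNumber 𝔸)) : c00 (killHom (𝕜 := 𝕜) q) = (c00 q).fst := rfl
/-- [folklore] -/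
@[simp] theorem c10_killHom (q : Tau (DualNumber 𝔸)) : c10 (killHom (𝕜 := 𝕜) q) = (c10 q).fst := rfl
/-- [folklore] -/
@[simp] theorem c01_killHom (q : Tau (DualNumber 𝔸)) : c01 (killHom (𝕜 := 𝕜) q) = (c01 q).fst := rfl
/-- [folklore] -/
@[simp] theorem c11_killHom (q : Tau (DualNumber 𝔸)) : c11 (killHom (𝕜 := 𝕜) q) = (c11 q).fst := rfl

/-- [folklore] THE LINE MAP `𝔸[ε] → Tau 𝔸`, `ε ↦ τ₁`: `(u₀, u₁) ↦ mk u₀ u₁ 0 0` (Mathlib's `inl`). -/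
def lineHom : DualNumber 𝔸 →ₐ[𝕜] Tau 𝔸 := TrivSqZeroExt.inlAlgHom 𝕜 (DualNumber 𝔸) (DualNumber 𝔸)

/-- [folklore] Components of the line map. -/
@[simp] theorem c00_lineHom (u : DualNumber 𝔸) : c00 (lineHom (𝕜 := 𝕜) u) = u.fst := rfl
/-- [folklore] -/
@[simp] theorem c10_lineHom (u : DualNumber 𝔸) : c10 (lineHom (𝕜 := 𝕜) u) = u.snd := rfl
/-- [folklore] -/
@[simp] theorem c01_lineHom (u : DualNumber 𝔸) : c01 (lineHom (𝕜 := 𝕜) u) = 0 := rfl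
/-- [folklore] -/
@[simp] theorem c11_lineHom (u : DualNumber 𝔸) : c11 (lineHom (𝕜 := 𝕜) u) = 0 := rfl

/-- [folklore] **`twist = kill + τ₁τ₂ · ι (ε-part of the augmentation)`**, pointwise on `Tau (𝔸[ε])`. -/
theorem twist_decomp (q : Tau (DualNumber 𝔸)) :
    twistHom (𝕜 := 𝕜) q = killHom (𝕜 := 𝕜) q + τ12 * ι (c10 (lineHom (𝕜 := 𝕜) (aug (𝕜 := 𝕜) q))) :=
  ext4 (by simp) (by simp) (by simp) (by simp)

/-- [folklore] THE `τ₁`-SIGN FLIP `τ₁ ↦ −τ₁` (`τ₂` fixed, `τ₁τ₂ ↦ −τ₁τ₂`): `mk a b c e ↦ mk a (−b) c (−e)`. -/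
def flip1 : Tau 𝔸 →ₐ[𝕜] Tau 𝔸 := mapDual (scaleDual (𝕜 := 𝕜) (-1 : 𝔸) fun t => by rw [neg_one_mul, mul_neg_one])

/-- [folklore] Components of the flip. -/
@[simp] theorem c00_flip1 (q : Tau 𝔸) : c00 (flip1 (𝕜 := 𝕜) q) = c00 q := rfl
/-- [folklore] -/
@[simp] theorem c10_flip1 (q : Tau 𝔸) : c10 (flip1 (𝕜 := 𝕜) q) = -c10 q := neg_one_mul _
/-- [folklore] -/
@[simp] theorem c01_flip1 (q : Tau 𝔸) : c01 (flip1 (𝕜 := 𝕜) q) = c01 q := rfl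
/-- [folklore] -/
@[simp] theorem c11_flip1 (q : Tau 𝔸) : c11 (flip1 (𝕜 := 𝕜) q) = -c11 q := neg_one_mul _

/-- [folklore] The flip fixes scalars. -/
@[simp] theorem flip1_ι (a : 𝔸) : flip1 (𝕜 := 𝕜) (ι a) = ι a := ext4 (by simp) (by simp) (by simp) (by simp)

/-! ## §2 Naturality of `QjetLAt` in the letter algebra; the `ε`-lifted letters -/

section Naturality

variable {R R' : Type*} [Ring R] [Algebra 𝕜 R] [Ring R'] [Algebra 𝕜 R'] (F : Tau R →ₐ[𝕜] Tau R')

/-- [folklore] The forward chart letter under a map of the letter algebra. -/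
theorem mapDual_GfL (ω E : Form1 d (Tau R)) (κ : Fin d) (x : Fin d → ℤ) :
    mapDual F (GfL ω E κ x) = GfL (fun κ x => F (ω κ x)) (fun κ x => F (E κ x)) κ x :=
  TrivSqZeroExt.ext (by simp) (by simp [map_mul])

/-- [folklore] The backward chart letter under a map of the letter algebra. -/
theorem mapDual_GbL (ω Eb : Form1 d (Tau R)) (κ : Fin d) (x : Fin d → ℤ) :
    mapDual F (GbL ω Eb κ x) = GbL (fun κ x => F (ω κ x)) (fun κ x => F (Eb κ x)) κ x :=
  TrivSqZeroExt.ext (by simp) (by simp [map_mul, map_neg])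

set_option synthInstance.maxHeartbeats 200000 in
set_option maxHeartbeats 1600000 in
/-- [folklore] **NATURALITY OF THE ROOTED JET IN THE LETTER ALGEBRA**: `F (QjetLAt ρ ω E Ē) = QjetLAt ρ (F∘ω) (F∘E) (F∘Ē)`. -/
theorem map_QjetLAt (ρ : Fin d → ℤ) (ω E Eb : Form1 d (Tau R)) (L : ℕ) (μ : Fin d) (y : Fin d → ℤ) :
    F (QjetLAt 𝕜 ρ ω E Eb L μ y)
      = QjetLAt 𝕜 ρ (fun κ x => F (ω κ x)) (fun κ x => F (E κ x)) (fun κ x => F (Eb κ x)) L μ y := by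
  unfold QjetLAt PhiLAt
  have key := congrArg TrivSqZeroExt.snd (map_logT (mapDual F)
    (PhiGAt 𝕜 ρ (GfL ω E) (GbL ω Eb) L μ y * invT (PhiGAt 𝕜 ρ (GfL 0 E) (GbL 0 Eb) L μ y)))
  simp only [map_mul, map_invT, map_PhiGAt, mapDual_GfL, mapDual_GbL, snd_mapDual, Pi.zero_apply, map_zero] at key
  exact key

end Naturality

/-- [folklore] The constant lift `Tau 𝔸 → Tau (𝔸[ε])` (no `ε`-part). -/
def liftT (q : Tau 𝔸) : Tau (DualNumber 𝔸) := Tau.mk (dmk (c00 q) 0) (dmk (c10 q) 0) (dmk (c01 q) 0) (dmk (c11 q) 0)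

/-- [folklore] Components of the lift. -/
@[simp] theorem c00_liftT (q : Tau 𝔸) : c00 (liftT q) = dmk (c00 q) 0 := rfl
/-- [folklore] -/
@[simp] theorem c10_liftT (q : Tau 𝔸) : c10 (liftT q) = dmk (c10 q) 0 := rfl
/-- [folklore] -/
@[simp] theorem c01_liftT (q : Tau 𝔸) : c01 (liftT q) = dmk (c01 q) 0 := rfl
/-- [folklore] -/
@[simp] theorem c11_liftT (q : Tau 𝔸) : c11 (liftT q) = dmk (c11 q) 0 := rfl

/-- [folklore] The lifted fluctuation letter. -/
def liftF (ω : Form1 d (Tau 𝔸)) : Form1 d (Tau (DualNumber 𝔸)) := fun κ x => liftT (ω κ x)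

/-- [folklore] The `ε`-TWISTED forward background `Ê · ι(1 + ε δ)`. -/
def twF (E : Form1 d (Tau 𝔸)) (δ : Form1 d 𝔸) : Form1 d (Tau (DualNumber 𝔸)) :=
  fun κ x => liftT (E κ x) * ι (dmk 1 (δ κ x))

/-- [folklore] The `ε`-TWISTED backward background `ι(1 − ε δ) · Ē̂`. -/
def twB (Eb : Form1 d (Tau 𝔸)) (δ : Form1 d 𝔸) : Form1 d (Tau (DualNumber 𝔸)) :=
  fun κ x => ι (dmk 1 (-δ κ x)) * liftT (Eb κ x)

variable (ω E Eb : Form1 d (Tau 𝔸)) (δ : Form1 d 𝔸) (κ : Fin d) (x : Fin d → ℤ)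

/-- [folklore] Images of the lifted letters under the TWIST map: the `τ₁τ₂`-twisted configuration. -/
@[simp] theorem twistHom_liftF : twistHom (𝕜 := 𝕜) (liftF ω κ x) = ω κ x :=
  ext4 (by simp [liftF]) (by simp [liftF]) (by simp [liftF]) (by simp [liftF])
/-- [folklore] -/
@[simp] theorem twistHom_twF : twistHom (𝕜 := 𝕜) (twF E δ κ x) = E κ x * (1 + τ12 * ι (δ κ x)) :=
  ext4 (by simp [twF]) (by simp [twF]) (by simp [twF]) (by simp [twF, mul_add]; abel)
/-- [folklore] -/
@[simp] theorem twistHom_twB : twistHom (𝕜 := 𝕜) (twB Eb δ κ x) = (1 - τ12 * ι (δ κ x)) * Eb κ x :=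
  ext4 (by simp [twB]) (by simp [twB]) (by simp [twB]) (by simp [twB, sub_mul]; abel)

/-- [folklore] Images under the KILL map: the untwisted configuration. -/
@[simp] theorem killHom_liftF : killHom (𝕜 := 𝕜) (liftF ω κ x) = ω κ x :=
  ext4 (by simp [liftF]) (by simp [liftF]) (by simp [liftF]) (by simp [liftF])
/-- [folklore] -/
@[simp] theorem killHom_twF : killHom (𝕜 := 𝕜) (twF E δ κ x) = E κ x :=
  ext4 (by simp [twF]) (by simp [twF]) (by simp [twF]) (by simp [twF])
/-- [folklore] -/
@[simp] theorem killHom_twB : killHom (𝕜 := 𝕜) (twB Eb δ κ x) = Eb κ x :=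
  ext4 (by simp [twB]) (by simp [twB]) (by simp [twB]) (by simp [twB])

/-- [folklore] Images under LINE ∘ AUGMENTATION: the SCALAR SHADOW configuration with `δ` in the `τ₁`-slot. -/
@[simp] theorem lineHom_aug_liftF : lineHom (𝕜 := 𝕜) (aug (𝕜 := 𝕜) (liftF ω κ x)) = ι (c00 (ω κ x)) :=
  ext4 (by simp [liftF]) (by simp [liftF]) (by simp [liftF]) (by simp [liftF])
/-- [folklore] -/
@[simp] theorem lineHom_aug_twF :
    lineHom (𝕜 := 𝕜) (aug (𝕜 := 𝕜) (twF E δ κ x)) = ι (c00 (E κ x)) * (1 + τ₁ * ι (δ κ x)) :=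
  ext4 (by simp [twF]) (by simp [twF, mul_add]) (by simp [twF]) (by simp [twF, mul_add])
/-- [folklore] -/
@[simp] theorem lineHom_aug_twB :
    lineHom (𝕜 := 𝕜) (aug (𝕜 := 𝕜) (twB Eb δ κ x)) = (1 - τ₁ * ι (δ κ x)) * ι (c00 (Eb κ x)) :=
  ext4 (by simp [twB]) (by simp [twB, sub_mul]) (by simp [twB]) (by simp [twB, sub_mul])

/-! ## §3 The twist lemma -/

set_option synthInstance.maxHeartbeats 200000 in
set_option maxHeartbeats 1600000 in
/-- [folklore] **THE `τ₁τ₂`-TWIST LEMMA.**  Twisting the background pair by `(1 + τ₁τ₂ιδ, 1 − τ₁τ₂ιδ)` shifts the rooted jet by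
`τ₁τ₂ · ι (c10 Q♭)`, `Q♭` the jet of the scalar-shadow configuration `(ι(c00 ω), ι(c00 E)(1+τ₁ιδ), (1−τ₁ιδ)ι(c00 Ē))`. -/
theorem QjetLAt_twist (ρ : Fin d → ℤ) (L : ℕ) (μ : Fin d) (y : Fin d → ℤ) :
    QjetLAt 𝕜 ρ ω (fun κ x => E κ x * (1 + τ12 * ι (δ κ x))) (fun κ x => (1 - τ12 * ι (δ κ x)) * Eb κ x) L μ y
      = QjetLAt 𝕜 ρ ω E Eb L μ y
        + τ12 * ι (c10 (QjetLAt 𝕜 ρ (fun κ x => ι (c00 (ω κ x))) (fun κ x => ι (c00 (E κ x)) * (1 + τ₁ * ι (δ κ x)))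
            (fun κ x => (1 - τ₁ * ι (δ κ x)) * ι (c00 (Eb κ x))) L μ y)) := by
  have h1 := map_QjetLAt (R := DualNumber 𝔸) (R' := 𝔸) (twistHom (𝕜 := 𝕜)) ρ (liftF ω) (twF E δ) (twB Eb δ) L μ y
  have h2 := map_QjetLAt (R := DualNumber 𝔸) (R' := 𝔸) (killHom (𝕜 := 𝕜)) ρ (liftF ω) (twF E δ) (twB Eb δ) L μ y
  have h3 := map_QjetLAt (R := DualNumber 𝔸) (R' := 𝔸) ((lineHom (𝕜 := 𝕜)).comp (aug (𝕜 := 𝕜))) ρ (liftF ω) (twF E δ)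
    (twB Eb δ) L μ y
  simp only [twistHom_liftF, twistHom_twF, twistHom_twB] at h1
  simp only [killHom_liftF, killHom_twF, killHom_twB] at h2
  simp only [AlgHom.comp_apply, lineHom_aug_liftF, lineHom_aug_twF, lineHom_aug_twB] at h3
  rw [← h1, twist_decomp, h2, h3]

/-- [folklore] **Components**: `c00`, `c10`, `c01` of the jet are UNCHANGED by the twist … -/
theorem c00_QjetLAt_twist (ρ : Fin d → ℤ) (L : ℕ) (μ : Fin d) (y : Fin d → ℤ) :
    c00 (QjetLAt 𝕜 ρ ω (fun κ x => E κ x * (1 + τ12 * ι (δ κ x))) (fun κ x => (1 - τ12 * ι (δ κ x)) * Eb κ x) L μ y)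
      = c00 (QjetLAt 𝕜 ρ ω E Eb L μ y) := by
  rw [QjetLAt_twist]; simp
/-- [folklore] -/
theorem c10_QjetLAt_twist (ρ : Fin d → ℤ) (L : ℕ) (μ : Fin d) (y : Fin d → ℤ) :
    c10 (QjetLAt 𝕜 ρ ω (fun κ x => E κ x * (1 + τ12 * ι (δ κ x))) (fun κ x => (1 - τ12 * ι (δ κ x)) * Eb κ x) L μ y)
      = c10 (QjetLAt 𝕜 ρ ω E Eb L μ y) := by
  rw [QjetLAt_twist]; simp
/-- [folklore] -/
theorem c01_QjetLAt_twist (ρ : Fin d → ℤ) (L : ℕ) (μ : Fin d) (y : Fin d → ℤ) :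
    c01 (QjetLAt 𝕜 ρ ω (fun κ x => E κ x * (1 + τ12 * ι (δ κ x))) (fun κ x => (1 - τ12 * ι (δ κ x)) * Eb κ x) L μ y)
      = c01 (QjetLAt 𝕜 ρ ω E Eb L μ y) := by
  rw [QjetLAt_twist]; simp

/-- [folklore] … and `c11` shifts by `c10` of the scalar-shadow jet. -/
theorem c11_QjetLAt_twist (ρ : Fin d → ℤ) (L : ℕ) (μ : Fin d) (y : Fin d → ℤ) :
    c11 (QjetLAt 𝕜 ρ ω (fun κ x => E κ x * (1 + τ12 * ι (δ κ x))) (fun κ x => (1 - τ12 * ι (δ κ x)) * Eb κ x) L μ y)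
      = c11 (QjetLAt 𝕜 ρ ω E Eb L μ y)
        + c10 (QjetLAt 𝕜 ρ (fun κ x => ι (c00 (ω κ x))) (fun κ x => ι (c00 (E κ x)) * (1 + τ₁ * ι (δ κ x)))
            (fun κ x => (1 - τ₁ * ι (δ κ x)) * ι (c00 (Eb κ x))) L μ y) := by
  rw [QjetLAt_twist]; simp

/-- [folklore] For AUGMENTATION-ONE backgrounds the scalar shadow is node 12b's chart `(Ebg δ 0, Ebi δ 0)`. -/
theorem shadow_eq_Ebg (hE : ∀ κ x, c00 (E κ x) = 1) :
    (fun κ x => ι (c00 (E κ x)) * (1 + τ₁ * ι (δ κ x))) = Ebg δ 0 := by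
  funext κ x; rw [hE, Ebg]; exact ext4 (by simp) (by simp) (by simp) (by simp)

/-- [folklore] -/
theorem shadow_eq_Ebi (hEb : ∀ κ x, c00 (Eb κ x) = 1) :
    (fun κ x => (1 - τ₁ * ι (δ κ x)) * ι (c00 (Eb κ x))) = Ebi δ 0 := by
  funext κ x; rw [hEb, Ebi]; exact ext4 (by simp) (by simp) (by simp) (by simp)

/-- [folklore] **THE TWIST LEMMA FOR AUGMENTATION-ONE BACKGROUNDS**: the `c11`-shift is `c10 (QjetAt ρ (ι∘c00∘ω) δ 0)`. -/
theorem c11_QjetLAt_twist_of_aug (hE : ∀ κ x, c00 (E κ x) = 1) (hEb : ∀ κ x, c00 (Eb κ x) = 1) (ρ : Fin d → ℤ) (L : ℕ)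
    (μ : Fin d) (y : Fin d → ℤ) :
    c11 (QjetLAt 𝕜 ρ ω (fun κ x => E κ x * (1 + τ12 * ι (δ κ x))) (fun κ x => (1 - τ12 * ι (δ κ x)) * Eb κ x) L μ y)
      = c11 (QjetLAt 𝕜 ρ ω E Eb L μ y) + c10 (QjetAt 𝕜 ρ (fun κ x => ι (c00 (ω κ x))) δ 0 L μ y) := by
  rw [c11_QjetLAt_twist, shadow_eq_Ebg E δ hE, shadow_eq_Ebi Eb δ hEb, QjetAt_eq_QjetLAt]

/-! ## §4 Oddness in `δ` and the symmetrised cancellation -/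

/-- [folklore] The flip on node 12b's background letters with empty `τ₂`-slot: `δ ↦ −δ`. -/
theorem flip1_Ebg_zero : flip1 (𝕜 := 𝕜) (Ebg δ 0 κ x) = Ebg (-δ) 0 κ x := ext4 (by simp) (by simp) (by simp) (by simp)
/-- [folklore] -/
theorem flip1_Ebi_zero : flip1 (𝕜 := 𝕜) (Ebi δ 0 κ x) = Ebi (-δ) 0 κ x := ext4 (by simp) (by simp) (by simp) (by simp)

set_option synthInstance.maxHeartbeats 200000 in
set_option maxHeartbeats 1600000 in
/-- [folklore] **ODDNESS**: for a SCALAR fluctuation letter `ι∘a`, `c10 (QjetAt ρ (ι∘a) (−δ) 0) = − c10 (QjetAt ρ (ι∘a) δ 0)`. -/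
theorem c10_QjetAt_neg (a : Form1 d 𝔸) (ρ : Fin d → ℤ) (L : ℕ) (μ : Fin d) (y : Fin d → ℤ) :
    c10 (QjetAt 𝕜 ρ (fun κ x => ι (a κ x)) (-δ) 0 L μ y) = -c10 (QjetAt 𝕜 ρ (fun κ x => ι (a κ x)) δ 0 L μ y) := by
  have h := map_QjetLAt (R := 𝔸) (R' := 𝔸) (flip1 (𝕜 := 𝕜)) ρ (fun κ x => ι (a κ x)) (Ebg δ 0) (Ebi δ 0) L μ y
  simp only [flip1_ι, flip1_Ebg_zero, flip1_Ebi_zero] at h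
  rw [QjetAt_eq_QjetLAt, QjetAt_eq_QjetLAt, ← h, c10_flip1]

/-- [folklore] **THE TWIST CANCELS UNDER `δ ↦ −δ` SYMMETRISATION**: for two augmentation-one background pairs twisted by OPPOSITE
`δ`, the sum of the `c11`-components of the jets equals the untwisted sum. -/
theorem c11_QjetLAt_twist_symm (E' Eb' : Form1 d (Tau 𝔸)) (hE : ∀ κ x, c00 (E κ x) = 1) (hEb : ∀ κ x, c00 (Eb κ x) = 1)
    (hE' : ∀ κ x, c00 (E' κ x) = 1) (hEb' : ∀ κ x, c00 (Eb' κ x) = 1) (ρ : Fin d → ℤ) (L : ℕ) (μ : Fin d) (y : Fin d → ℤ) :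
    c11 (QjetLAt 𝕜 ρ ω (fun κ x => E κ x * (1 + τ12 * ι (δ κ x))) (fun κ x => (1 - τ12 * ι (δ κ x)) * Eb κ x) L μ y)
      + c11 (QjetLAt 𝕜 ρ ω (fun κ x => E' κ x * (1 + τ12 * ι ((-δ) κ x))) (fun κ x => (1 - τ12 * ι ((-δ) κ x)) * Eb' κ x)
          L μ y)
      = c11 (QjetLAt 𝕜 ρ ω E Eb L μ y) + c11 (QjetLAt 𝕜 ρ ω E' Eb' L μ y) := by
  rw [c11_QjetLAt_twist_of_aug ω E Eb δ hE hEb, c11_QjetLAt_twist_of_aug ω E' Eb' (-δ) hE' hEb', c10_QjetAt_neg]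
  abel

end Summit.QuantumFields.BalabanUV.Beta.RootedJetTwist
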